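/-
Copyright (c) 2026 the pub-hodgecm-mathlib formalisation cell (harness21).  Prover seat hodgecm-mathlib-K2E1-p10 (g4), Track B «K2-LIT»,
hLiu418 = stmt-HodgeConjecture-24832, road `K2_Liu`, organ F4 (G-gen), road (E) (LEAD F0P6-plan M-158r; F4 lead K2Liu-p27 M-158s), bricks (E-a2)+(E-a3) BY NAME:
THE FIRST FUNDAMENTAL THEOREM FOR `GL_p` ON TWO VECTORS AND TWO COVECTORS, read from the tree's ★ Goodman–Wallach Thm. 5.2.1.  2026-09-04.
-/
import Summits.HodgeConjecture.HodgeConjecture.Theorems.K2LiuUnitaryPolySubstDefs               -- ★ (E-a0) `polySubst`, `contraction`, `IsGLInvariant`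
import Literature.RepresentationTheory.ClassicalInvariants.GeneralLinearPolynomialFFTGeneral     -- ★ Goodman–Wallach Thm. 5.2.1 (polynomial FFT for `GL(V)`, any `k, m`)
import Summits.HodgeConjecture.HodgeConjecture.Theorems.K2LiuUnitaryZariskiDensity              -- ★ (E-a1) `isGLInvariant_iff_isUnitaryInvariant` (K2Liu-p26)
import HarnessLib

/-!
# Crux `HLiu418`, organ F4 (G-gen), road (E), bricks (E-a2)+(E-a3): THE FIRST FUNDAMENTAL THEOREM FOR `GL_p` ON `K[x_{ia}, y_{ja}]`
# (`i, j < 2`) — `K[x,y]^{GL_p} = K[c_{00}, c_{01}, c_{10}, c_{11}]` — BY NAME from the tree's ★ polynomial FFT (`Theorems/K2LiuUnitaryFFTContractions.lean`)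

Cell `hodgecm-mathlib`, crux item hLiu418 = `stmt-HodgeConjecture-24832`; squad K2 ∕ K2Liu; F4 lead K2Liu-p27 (g2) (M-158s brick list: (E-a2) `K2LiuUnitaryFFTContractionsTwo`
«`p ≤ 2` by the `X⁻¹` trick», (E-a3) «general `p`, second priority»).  K2E1-p10 (g4) CENSUS CORRECTION 2026-09-04T23:14Z: the tree ALREADY holds the polynomial
first fundamental theorem for `GL(V)` with ANY numbers of vectors and covectors, proved (lane `lit-hodgefound`):
★ `Literature.RepresentationTheory.ClassicalInvariants.GeneralLinearPolynomialFFT.forall_aeval_glSubst_eq_iff_mem_range_aeval_contraction`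
(`GeneralLinearPolynomialFFTGeneral.lean`; Goodman–Wallach GTM 255 Thm. 5.2.1, Weyl Thm. 2.6.A).  THIS FILE is the ADAPTER to the (E) road's currency
(★ (E-a0) `K2LiuUnitaryPolySubstDefs`): the Literature indexes the variables `(GL index, label)`, (E-a0) indexes them `(label, GL index)`; under the swap
`MvPolynomial.rename (Equiv.sumCongr (Equiv.prodComm) (Equiv.prodComm))` the substitution `x ↦ x·g`, `y ↦ y·(g⁻¹)ᵀ` and the four contractions correspond
TOKEN FOR TOKEN, so (E-a2) AND (E-a3) hold for EVERY `p` over every field of characteristic `0`: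
**`isGLInvariant_iff_mem_adjoin : IsGLInvariant f ↔ f ∈ Algebra.adjoin K (Set.range fun ij : Fin 2 × Fin 2 => contraction ij.1 ij.2)`**.
(The `U(p)`-form over `ℂ` then follows from (E-a1) `IsUnitaryInvariant f → IsGLInvariant f`, K2Liu-p26 (g2).)  THEOREMS + ONE definition with body (the index
swap `idxSwap`); no instance, no notation, no named-fact hypothesis, no `sorry`; lane `--kind definition --supports stmt-HodgeConjecture-24832 --as helper`.
* §1 `idxSwap` and the dictionary: `rename_substFun` ∕ **`rename_polySubst`** (`rename idxSwap (σ_g f) = glSubst_g (rename idxSwap f)` — the Literature's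
  substitution, written inline as the Literature does), **`rename_contraction`** (`rename idxSwap (c_{ij}) = Σ_p x_{(p,i)} y_{(p,j)}`);
* §2 **`isGLInvariant_iff_mem_adjoin`** (FFT, both directions; `⊇` is ★ (E-a0) `isGLInvariant_of_mem_adjoin`, `⊆` is ★ Thm. 5.2.1 transported) and the `∃ F` form
  **`exists_eq_aeval_contraction_of_isGLInvariant`**;
* §3 (`K = ℂ`) **`isUnitaryInvariant_iff_mem_adjoin`** — the `U(p)` FIRST FUNDAMENTAL THEOREM the (E) road's STEP 1 reads (★ (E-a1)
  `K2LiuUnitaryZariskiDensity.isGLInvariant_iff_isUnitaryInvariant`, K2Liu-p26 (g2), ∘ §2), and its `∃ F` form.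
References: [GoodmanWallach2009] R. Goodman, N. R. Wallach, *Symmetry, Representations, and Invariants*, GTM 255 (2009), Thm. 5.2.1; [Weyl1939] H. Weyl,
*The Classical Groups*, Thm. 2.6.A; [Howe1989Remarks] R. Howe, Trans. AMS 313 (1989), Thm. 1A ∕ Thm. 2.
HONEST LABEL.  Count-neutral adapter (no new invariant theory: the FFT is the tree's ★ Literature theorem); `HC_CM` is proved only modulo the 7 printed citations
(2 remaining named inputs: hLiu418 = `stmt-HodgeConjecture-24832`, h413 = `stmt-HodgeConjecture-24833`) until rung 0 closes.

## Tree search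
★ `GeneralLinearPolynomialFFT.forall_aeval_glSubst_eq_iff_mem_range_aeval_contraction` (`GeneralLinearPolynomialFFTGeneral.lean` :467), ★ (E-a0)
`polySubst_X`, `substFun_inl∕_inr`, `contraction_def`, `isGLInvariant_of_mem_adjoin`; Mathlib `MvPolynomial.rename`, `rename_X`, `rename_rename`,
`rename_id`, `MvPolynomial.algHom_ext`, `MvPolynomial.aeval_range`, `comp_aeval`, `smul_eq_C_mul`.  Dedup: `rg "isGLInvariant_iff_mem_adjoin|idxSwap|rename_polySubst"`
over `Theorems/` + `Literature/` — none.
-/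

set_option autoImplicit false
set_option linter.dupNamespace false -- the mandated namespace repeats `HodgeConjecture.HodgeConjecture`

noncomputable section

open MvPolynomial Matrix
open Summit.HodgeConjecture.HodgeConjecture.Cruxes.HLiu418.K2LiuUnitaryPolySubstDefs
open Literature.RepresentationTheory.ClassicalInvariants.GeneralLinearPolynomialFFT
open Summit.HodgeConjecture.HodgeConjecture.Cruxes.HLiu418

namespace Summit.HodgeConjecture.HodgeConjecture.Cruxes.HLiu418.K2LiuUnitaryFFTContractions

variable {K : Type*} [Field K] {p : ℕ}

/-! ## §1 The index dictionary `(label, GL index) ↔ (GL index, label)` -/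

/-- **the index swap** `(i, a) ↦ (a, i)` on vector and covector coordinates alike: (E-a0)'s `(Fin 2 × Fin p) ⊕ (Fin 2 × Fin p)` ↔ the Literature's
`(Fin p × Fin 2) ⊕ (Fin p × Fin 2)`. [folklore] -/
def idxSwap (p : ℕ) : (Fin 2 × Fin p) ⊕ (Fin 2 × Fin p) ≃ (Fin p × Fin 2) ⊕ (Fin p × Fin 2) :=
  Equiv.sumCongr (Equiv.prodComm (Fin 2) (Fin p)) (Equiv.prodComm (Fin 2) (Fin p))

/-- `idxSwap` on a vector coordinate. [folklore] -/
theorem idxSwap_inl (i : Fin 2) (a : Fin p) : idxSwap p (Sum.inl (i, a)) = Sum.inl (a, i) := rfl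

/-- `idxSwap` on a covector coordinate. [folklore] -/
theorem idxSwap_inr (j : Fin 2) (a : Fin p) : idxSwap p (Sum.inr (j, a)) = Sum.inr (a, j) := rfl

/-- `idxSwap⁻¹` on a vector coordinate. [folklore] -/
theorem idxSwap_symm_inl (a : Fin p) (i : Fin 2) : (idxSwap p).symm (Sum.inl (a, i)) = Sum.inl (i, a) := rfl

/-- `idxSwap⁻¹` on a covector coordinate. [folklore] -/
theorem idxSwap_symm_inr (a : Fin p) (j : Fin 2) : (idxSwap p).symm (Sum.inr (a, j)) = Sum.inr (j, a) := rfl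

/-- **THE SUBSTITUTIONS AGREE**: transporting (E-a0)'s substituted variable `substFun g v` along `idxSwap` gives the Literature's substitution at `idxSwap v`
(`x_{(p,i)} ↦ Σ_q g_{qp} x_{(q,i)}`, `y_{(p,j)} ↦ Σ_q (g⁻¹)_{pq} y_{(q,j)}`). [cite: GoodmanWallach2009, Thm. 5.2.1] [cite: Weyl1939, Thm. 2.6.A] -/
theorem rename_substFun (g : GL (Fin p) K) (v : (Fin 2 × Fin p) ⊕ (Fin 2 × Fin p)) :
    rename (idxSwap p) (substFun g v) =
      Sum.elim
        (fun pi : Fin p × Fin 2 => ∑ q, (g : Matrix (Fin p) (Fin p) K) q pi.1 • (X (Sum.inl (q, pi.2)) :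
          MvPolynomial ((Fin p × Fin 2) ⊕ (Fin p × Fin 2)) K))
        (fun pj : Fin p × Fin 2 => ∑ q, ((g⁻¹ : GL (Fin p) K) : Matrix (Fin p) (Fin p) K) pj.1 q •
          (X (Sum.inr (q, pj.2)) : MvPolynomial ((Fin p × Fin 2) ⊕ (Fin p × Fin 2)) K)) (idxSwap p v) := by
  rcases v with ⟨i, a⟩ | ⟨j, a⟩
  · rw [substFun_inl, idxSwap_inl, Sum.elim_inl, map_sum]
    refine Finset.sum_congr rfl fun b _ => ?_
    rw [map_mul, rename_X, rename_C, idxSwap_inl, smul_eq_C_mul, mul_comm]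
  · rw [substFun_inr, idxSwap_inr, Sum.elim_inr, map_sum]
    refine Finset.sum_congr rfl fun b _ => ?_
    rw [map_mul, rename_X, rename_C, idxSwap_inr, smul_eq_C_mul, mul_comm]

/-- **`rename idxSwap ∘ σ_g = glSubst_g ∘ rename idxSwap`**: (E-a0)'s action IS the Literature's action under the index dictionary.
[cite: GoodmanWallach2009, Thm. 5.2.1] [cite: Weyl1939, Thm. 2.6.A] -/
theorem rename_polySubst (g : GL (Fin p) K) (f : MvPolynomial ((Fin 2 × Fin p) ⊕ (Fin 2 × Fin p)) K) :
    rename (idxSwap p) (polySubst g f) =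
      aeval (Sum.elim
        (fun pi : Fin p × Fin 2 => ∑ q, (g : Matrix (Fin p) (Fin p) K) q pi.1 • (X (Sum.inl (q, pi.2)) :
          MvPolynomial ((Fin p × Fin 2) ⊕ (Fin p × Fin 2)) K))
        (fun pj : Fin p × Fin 2 => ∑ q, ((g⁻¹ : GL (Fin p) K) : Matrix (Fin p) (Fin p) K) pj.1 q •
          (X (Sum.inr (q, pj.2)) : MvPolynomial ((Fin p × Fin 2) ⊕ (Fin p × Fin 2)) K))) (rename (idxSwap p) f) := by
  -- both sides are `K`-algebra maps in `f`; compare them on the variables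
  suffices h : (rename (idxSwap p)).comp (polySubst g) =
      (aeval (Sum.elim
        (fun pi : Fin p × Fin 2 => ∑ q, (g : Matrix (Fin p) (Fin p) K) q pi.1 • (X (Sum.inl (q, pi.2)) :
          MvPolynomial ((Fin p × Fin 2) ⊕ (Fin p × Fin 2)) K))
        (fun pj : Fin p × Fin 2 => ∑ q, ((g⁻¹ : GL (Fin p) K) : Matrix (Fin p) (Fin p) K) pj.1 q •
          (X (Sum.inr (q, pj.2)) : MvPolynomial ((Fin p × Fin 2) ⊕ (Fin p × Fin 2)) K)))).comp (rename (idxSwap p)) from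
    AlgHom.congr_fun h f
  refine MvPolynomial.algHom_ext fun v => ?_
  rw [AlgHom.comp_apply, AlgHom.comp_apply, polySubst_X, rename_X, aeval_X, rename_substFun]

/-- **THE CONTRACTIONS AGREE**: `rename idxSwap (c_{ij}) = Σ_p x_{(p,i)} y_{(p,j)}`, the Literature's contraction at `(i, j)`.
[cite: GoodmanWallach2009, Thm. 5.2.1] [cite: Weyl1939, Thm. 2.6.A] -/
theorem rename_contraction (i j : Fin 2) :
    rename (idxSwap p) (contraction i j : MvPolynomial ((Fin 2 × Fin p) ⊕ (Fin 2 × Fin p)) K) =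
      ∑ q : Fin p, (X (Sum.inl (q, i)) : MvPolynomial ((Fin p × Fin 2) ⊕ (Fin p × Fin 2)) K) * X (Sum.inr (q, j)) := by
  rw [contraction_def, map_sum]
  refine Finset.sum_congr rfl fun a _ => ?_
  rw [map_mul, rename_X, rename_X, idxSwap_inl, idxSwap_inr]

/-- the dictionary the other way: `rename idxSwap⁻¹` of the Literature's contraction at `(i, j)` is `c_{ij}`. [folklore] -/
theorem rename_symm_contraction (ij : Fin 2 × Fin 2) :
    rename (idxSwap p).symm (∑ q : Fin p, (X (Sum.inl (q, ij.1)) : MvPolynomial ((Fin p × Fin 2) ⊕ (Fin p × Fin 2)) K) * X (Sum.inr (q, ij.2))) =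
      contraction ij.1 ij.2 := by
  rw [← rename_contraction, rename_rename, Equiv.symm_comp_self, rename_id, AlgHom.id_apply]

/-! ## §2 The first fundamental theorem in (E-a0) currency -/

/-- **(E-a2)+(E-a3) — FIRST FUNDAMENTAL THEOREM FOR `GL_p` ON TWO VECTORS AND TWO COVECTORS** (every `p`, every field of characteristic `0`):
a polynomial `f ∈ K[x_{ia}, y_{ja}]` (`i, j < 2`, `a < p`) is invariant under `x ↦ x·g`, `y ↦ y·(g⁻¹)ᵀ` for all `g ∈ GL_p(K)` IF AND ONLY IF it is a polynomial in the
four contractions `c_{ij} = Σ_a x_{ia} y_{ja}` — Goodman–Wallach Thm. 5.2.1 (★ `forall_aeval_glSubst_eq_iff_mem_range_aeval_contraction`) transported along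
`idxSwap`; the inclusion `⊇` is ★ (E-a0) `isGLInvariant_of_mem_adjoin`. [cite: GoodmanWallach2009, Thm. 5.2.1] [cite: Weyl1939, Thm. 2.6.A] [cite: Howe1989Remarks, Thm. 1A] -/
theorem isGLInvariant_iff_mem_adjoin [CharZero K] (f : MvPolynomial ((Fin 2 × Fin p) ⊕ (Fin 2 × Fin p)) K) :
    IsGLInvariant f ↔ f ∈ Algebra.adjoin K (Set.range fun ij : Fin 2 × Fin 2 =>
      (contraction ij.1 ij.2 : MvPolynomial ((Fin 2 × Fin p) ⊕ (Fin 2 × Fin p)) K)) := by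
  refine ⟨fun hf => ?_, isGLInvariant_of_mem_adjoin⟩
  -- transport `f` to the Literature's indexing and read Thm. 5.2.1 there
  have hf' : ∀ g : GL (Fin p) K, aeval (Sum.elim
        (fun pi : Fin p × Fin 2 => ∑ q, (g : Matrix (Fin p) (Fin p) K) q pi.1 • (X (Sum.inl (q, pi.2)) :
          MvPolynomial ((Fin p × Fin 2) ⊕ (Fin p × Fin 2)) K))
        (fun pj : Fin p × Fin 2 => ∑ q, ((g⁻¹ : GL (Fin p) K) : Matrix (Fin p) (Fin p) K) pj.1 q •
          (X (Sum.inr (q, pj.2)) : MvPolynomial ((Fin p × Fin 2) ⊕ (Fin p × Fin 2)) K))) (rename (idxSwap p) f) =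
      rename (idxSwap p) f := fun g => by
    rw [← rename_polySubst, hf g]
  obtain ⟨F, hF⟩ := (AlgHom.mem_range _).1
    ((forall_aeval_glSubst_eq_iff_mem_range_aeval_contraction (β := Fin 2) (γ := Fin 2) (rename (idxSwap p) f)).1 hf')
  -- transport back: `f = rename idxSwap⁻¹ (aeval c′ F) = aeval (c ∘ ·) F`
  have hback : rename (idxSwap p).symm (rename (idxSwap p) f) = f := by
    rw [rename_rename, Equiv.symm_comp_self, rename_id, AlgHom.id_apply]
  have hfun : (fun ij : Fin 2 × Fin 2 => rename (idxSwap p).symm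
      (∑ q : Fin p, (X (Sum.inl (q, ij.1)) : MvPolynomial ((Fin p × Fin 2) ⊕ (Fin p × Fin 2)) K) * X (Sum.inr (q, ij.2)))) =
      fun ij : Fin 2 × Fin 2 => (contraction ij.1 ij.2 : MvPolynomial ((Fin 2 × Fin p) ⊕ (Fin 2 × Fin p)) K) :=
    funext fun ij => rename_symm_contraction ij
  rw [← hback, ← hF, ← AlgHom.comp_apply, comp_aeval, hfun, ← aeval_range]
  exact (AlgHom.mem_range _).2 ⟨F, rfl⟩

/-- **the `∃ F` form**: a `GL_p`-invariant `f` is `F(c_{00}, c_{01}, c_{10}, c_{11})` for some `F ∈ K[z_{ij}]`. [cite: GoodmanWallach2009, Thm. 5.2.1] [cite: Weyl1939, Thm. 2.6.A] -/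
theorem exists_eq_aeval_contraction_of_isGLInvariant [CharZero K] {f : MvPolynomial ((Fin 2 × Fin p) ⊕ (Fin 2 × Fin p)) K} (hf : IsGLInvariant f) :
    ∃ F : MvPolynomial (Fin 2 × Fin 2) K,
      f = aeval (fun ij : Fin 2 × Fin 2 => (contraction ij.1 ij.2 : MvPolynomial ((Fin 2 × Fin p) ⊕ (Fin 2 × Fin p)) K)) F := by
  have h := (isGLInvariant_iff_mem_adjoin f).1 hf
  rw [← aeval_range] at h
  obtain ⟨F, hF⟩ := (AlgHom.mem_range _).1 h
  exact ⟨F, hF.symm⟩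


/-! ## §3 `K = ℂ`: the `U(p)` first fundamental theorem (∘ ★ (E-a1)) -/

/-- **(E) STEP 1's INVARIANT THEORY, BY NAME — THE `U(p)` FIRST FUNDAMENTAL THEOREM ON TWO VECTORS AND TWO COVECTORS**: a polynomial
`f ∈ ℂ[x_{ia}, y_{ja}]` is invariant under `x ↦ x·u`, `y ↦ y·ū` for all `u ∈ U(p)` IF AND ONLY IF it is a polynomial in the four contractions `c_{ij}`
(★ (E-a1) unitarian trick `isGLInvariant_iff_isUnitaryInvariant` ∘ §2). [cite: GoodmanWallach2009, Thm. 5.2.1] [cite: Howe1989Remarks, Thm. 1A] [cite: KashiwaraVergne1978, §II] -/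
theorem isUnitaryInvariant_iff_mem_adjoin (f : MvPolynomial ((Fin 2 × Fin p) ⊕ (Fin 2 × Fin p)) ℂ) :
    IsUnitaryInvariant f ↔ f ∈ Algebra.adjoin ℂ (Set.range fun ij : Fin 2 × Fin 2 =>
      (contraction ij.1 ij.2 : MvPolynomial ((Fin 2 × Fin p) ⊕ (Fin 2 × Fin p)) ℂ)) := by
  rw [← K2LiuUnitaryZariskiDensity.isGLInvariant_iff_isUnitaryInvariant]
  exact isGLInvariant_iff_mem_adjoin f

/-- the `∃ F` form of §3: a `U(p)`-invariant `f` is `F(c_{00}, c_{01}, c_{10}, c_{11})`. [cite: GoodmanWallach2009, Thm. 5.2.1] [cite: KashiwaraVergne1978, §II] -/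
theorem exists_eq_aeval_contraction_of_isUnitaryInvariant {f : MvPolynomial ((Fin 2 × Fin p) ⊕ (Fin 2 × Fin p)) ℂ} (hf : IsUnitaryInvariant f) :
    ∃ F : MvPolynomial (Fin 2 × Fin 2) ℂ,
      f = aeval (fun ij : Fin 2 × Fin 2 => (contraction ij.1 ij.2 : MvPolynomial ((Fin 2 × Fin p) ⊕ (Fin 2 × Fin p)) ℂ)) F :=
  exists_eq_aeval_contraction_of_isGLInvariant (K2LiuUnitaryZariskiDensity.isGLInvariant_of_isUnitaryInvariant hf)

end Summit.HodgeConjecture.HodgeConjecture.Cruxes.HLiu418.K2LiuUnitaryFFTContractions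

end
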